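import Summits.ABC.StewartYu.RecordByNameV
import Summits.ABC.StewartYu.RecordByName1
import Summits.ABC.StewartYu.RecordOddMono
import HarnessLib

/-!
# Cell abc-stewartyu, Gen-3 record (WP-M3.R, odd `p`): the record predicate FOR A DATUM — both branches, any cell
# constant `c ≥ 256`, the datum's own height bound `Vmax`

`Summits/ABC/StewartYu/RecordDatum.lean` — cell `abc-stewartyu` (HOME `run/shared/lean/pub/abc-stewartyu/`),
route `PadicPrimesKummerThird`, crux `Y07Odd` (stmt-ABC-19658), registered stubs `stub_endRecordV` (`m = 0`) and
`stub_endRecord1` (`1 ≤ m`) of the F-odd skeleton (p2-g4, HOME/p2/lean/g4/Y07Odd.lean); seat lp-1 (g3).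
Theorems only.

The two records by name — `PadicG3Par.recordOddV_end` (v2 family `PadicG3ParV`, `m = 0`, `RecordByNameV` p496268)
and `PadicG3Par.recordOdd1_end` (v1 family, `n ≥ 2`, `RecordByName1` p496222) — packaged for the frame's
parameter record of a datum (planner g9 rulings R21-b/R21-c, STATUS 2026-08-27T04:24:02Z):
* the instantiation convention as FIELD FACTS of the datum record: `N_q = K` (R21-b), `θ₀ = ½`, `K₀ = p − 1`,
  `1 ≤ Aⱼ`, and the height bound `Amax ≤ 2ⁿ·Ω` together with `Amax ≤ Vmax` (take `Amax := min Vmax (2ⁿ·∏V)` as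
  `parTwo` does at `p = 2`) — the record is then LIFTED to the datum's `Vmax` by `recordOdd_mono_Vmax`;
* any growth constant `c ≥ 256` (`recordOdd_mono_base`; the cell constant `cY07` of R21-c);
* END slots `(D₀V, S₀NV, ⌊2ⁿ·XsV ŜG/(2(n+1))⌋, DV)` resp. `(D₀, S₀N, ⌊2ⁿ·X_Ŝ/(2(n+1))⌋, D)` = p2's
  `S.XfinOS P.schedV` / `S.XfinOS P.sched1` after `unfold XfinOS NS` and the `schedV_*`/`sched1_*` rfl lemmas.

References: Yu. V. Nesterenko, LNM 1819 (2003), §5.2 (5.12)–(5.22).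
-/

noncomputable section

open Finset Real

namespace Summit.ABC.StewartYu

namespace PadicG3Par

open Summit.ABC.StewartYu.GenThreeFrameSpecOdd (RecordOdd recordOdd_mono_Vmax recordOdd_mono_base)

variable {n : ℕ} (P : PadicG3Par n)

/-- `N_q = K` gives the convention `K ≤ N_q ≤ 2ⁿ·K`. [folklore] -/
theorem convention_of_Nq_eq_K (hNq : P.Nq = P.K) : P.K ≤ P.Nq ∧ P.Nq ≤ 2 ^ n * P.K := by
  rw [hNq]
  exact ⟨le_rfl, Nat.le_mul_of_pos_left _ (Nat.two_pow_pos n)⟩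

/-- `K₀ = p − 1` gives `(p : ℝ) − 1 ≤ K₀`. [folklore] -/
theorem K₀_ge_of_eq (hK₀ : P.K₀ = P.p - 1) : (P.p : ℝ) - 1 ≤ P.K₀ := by
  rw [hK₀]
  have hp := P.hp
  push_cast [Nat.cast_sub (by omega : 1 ≤ P.p)]
  exact le_rfl

/-- **THE DATUM RECORD, branch `m = 0`** (v2 family): for a record with `p ≥ 3`, `N_q = K`, `K₀ = p − 1`, `θ₀ = ½`,
`1 ≤ Aⱼ`, `Amax ≤ 2ⁿ·Ω`, `Amax ≤ Vmax`, `0 ≤ W`, and any `c ≥ 256`: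
`RecordOdd (c^·) p n P.A Vmax P.W D₀V S₀NV ⌊2ⁿ·XsV ŜG/(2(n+1))⌋ DV`. [cite: Nesterenko2003, §5.2 (5.12)–(5.22)] -/
theorem recordOddV_datum (hm : P.m = 0) (hp3 : 3 ≤ P.p) (hK₀ : P.K₀ = P.p - 1) (hNq : P.Nq = P.K)
    (hθ : P.θ₀ = 1 / 2) (hA1 : ∀ j, 1 ≤ P.A j) (hAmaxΩ : P.Amax ≤ 2 ^ n * P.Ω)
    {Vmax : ℝ} (hAmaxV : P.Amax ≤ Vmax) (hW0 : 0 ≤ P.W) (p : ℕ) {c : ℝ} (hc : 256 ≤ c) :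
    RecordOdd (fun m => c ^ m) p n P.A Vmax P.W P.D0V P.S0NV (2 ^ n * P.XsV P.SdG / (2 * (n + 1))) P.DV := by
  obtain ⟨hKNq, hNqK⟩ := P.convention_of_Nq_eq_K hNq
  have hrec := P.recordOddV_end hm hp3 (P.K₀_ge_of_eq hK₀) hKNq hNqK (by rw [hθ]) hAmaxΩ hA1 p
  have h256 := recordOdd_mono_base (by norm_num : (1 : ℝ) ≤ 256) hc hA1 hW0 P.hAmax1 hrec
  exact recordOdd_mono_Vmax (fun r => by positivity) P.hn hA1 hW0 P.hAmax1 hAmaxV h256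

/-- **THE DATUM RECORD, branch `1 ≤ m`** (v1 family, `n ≥ 2`): for a record with `N_q = K`, `θ₀ = ½`, `1 ≤ Aⱼ`,
`Amax ≤ 2ⁿ·Ω`, `Amax ≤ Vmax`, `0 ≤ W`, and any `c ≥ 256`:
`RecordOdd (c^·) p n P.A Vmax P.W D₀ S₀N ⌊2ⁿ·X_Ŝ/(2(n+1))⌋ D`. [cite: Nesterenko2003, §5.2 (5.12)–(5.22)] -/
theorem recordOdd1_datum (hn : 2 ≤ n) (hNq : P.Nq = P.K) (hθ : P.θ₀ = 1 / 2) (hA1 : ∀ j, 1 ≤ P.A j)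
    (hAmaxΩ : P.Amax ≤ 2 ^ n * P.Ω) {Vmax : ℝ} (hAmaxV : P.Amax ≤ Vmax) (hW0 : 0 ≤ P.W) (p : ℕ)
    {c : ℝ} (hc : 256 ≤ c) :
    RecordOdd (fun m => c ^ m) p n P.A Vmax P.W P.D₀ P.S₀N (2 ^ n * P.Xs P.Sdepth / (2 * (n + 1))) P.D := by
  obtain ⟨hKNq, hNqK⟩ := P.convention_of_Nq_eq_K hNq
  have hrec := P.recordOdd1_end hn hKNq hNqK (by rw [hθ]) hAmaxΩ hA1 p
  have h256 := recordOdd_mono_base (by norm_num : (1 : ℝ) ≤ 256) hc hA1 hW0 P.hAmax1 hrec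
  exact recordOdd_mono_Vmax (fun r => by positivity) P.hn hA1 hW0 P.hAmax1 hAmaxV h256

end PadicG3Par

end Summit.ABC.StewartYu

end
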